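import Literature.AlgebraicGeometry.Frobenioids.BaseSectionImage
import Literature.AlgebraicGeometry.Frobenioids.BaseSectionsOfObjects
import Literature.AlgebraicGeometry.Frobenioids.BaseCategoryTheoreticity
import Literature.AlgebraicGeometry.Frobenioids.DivisorMonoidCategoryTheoreticity
import HarnessLib

/-!
# Frobenioids I, Corollary 5.7 (Category-theoreticity of Base-Sections): (i), (ii) — PROOFS modulo the
# typed Theorem 3.4 (iii) and Corollary 4.11 (ii)

Mochizuki, *The geometry of Frobenioids I: the general theory*, Kyushu J. Math. **62** (2008)
293–400, kurims text Cor. 5.7 pp. 107–108, proof p. 108 ll. 15–21 [cite: MochizukiFrdI2008, Cor. 5.7 p.108]: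
"sorting through the definitions, to verify assertions (i), (ii), (iii), (iv) it suffices to show that `Ψ`
preserves isotropic objects, prime-Frobenius morphisms, pull-back morphisms, birationalizations, the
natural projection functor `C_i → D_i` [hence, in particular, the units `O^×(−)`], and … Frobenius
degrees. But this follows from Theorem 3.4, (i), (iii); Corollary 4.10; Corollary 4.11, (ii)."

PROOF-ONLY companion of `BaseSectionsOfObjects.lean` (statements, seat abc-iut-L1-t5). Following the
printed reduction, each part of Cor. 5.7 is proved FROM the typed conclusion predicates of [FrdI]
Thm. 3.4 (iii) (`PreFrobenioidData.Thm34iii`: `Ψ` preserves pull-back morphisms and morphisms of Frobenius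
type, and acts on degrees through `Ψ^{N_{≥1}}`) and Cor. 4.11 (ii) (`PreFrobenioidData.Cor411ii`: the
`1`-unique equivalence `Ψ^Base : D₁ ⥲ D₂` under `Ψ`), instantiated on the operations
`PreFrobenioidData.ofFunctor Φ_i F_i` of the two Frobenioids (statement files of seat abc-iut-L1-t3; those
theorems are discharged separately):

* `cor57ii_of_cor411ii`: (ii) "`C₁` is of unit-profinite type iff `C₂` is" from Cor. 4.11 (ii) alone
  (`Ψ` over `Ψ^Base` identifies `O^×(A)` and `O^×(Ψ A)`);
* `cor57i_sections_of`: (i) base-sections — the image `Ψ(P₁)` is a base-section (`BaseSectionImage.lean`);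
* `cor57i_pairs_core` / `cor57i_pairs_of`: (i) quasi-base-Frobenius pairs — `F₂(m)_{Ψ A} :=
  Ψ(F₁((Ψ^{N_{≥1}})⁻¹ m)_A)`, well defined by object-rigidity of base-sections; the matching automorphism of
  `N_{≥1}` is `τ = Ψ^{N_{≥1}}` (the "quasi-" of the printed statement);
* `isOfPreModelType_iff_of`: (i) "in particular, `C₁` is of model type iff `C₂` is", PRE-MODEL half
  (Def. 2.7 (iii)), using the predicates for `Ψ` and `Ψ⁻¹`; the Def. 4.5 (i) half of `Cor57i_model` is a
  schema over birationalization data and is not asserted here.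

Parts (iii), (iv) are in `BaseSectionsOfObjectsCor57bProofs.lean`. Nothing here is specific to the abc
programme; no statement of the paper is strengthened; the typed targets are proved exactly as stated.
-/

namespace Literature.AlgebraicGeometry.Frobenioids

open CategoryTheory Opposite

universe w v v' u u'

namespace PreFrobenioid

section Cor57

variable {D₁ : Type u} [Category.{v} D₁] {Φ₁ : D₁ᵒᵖ ⥤ CommMonCat.{w}}
  {C₁ : Type u'} [Category.{v'} C₁] (F₁ : C₁ ⥤ ElemFrobenioid Φ₁)
  {D₂ : Type u} [Category.{v} D₂] {Φ₂ : D₂ᵒᵖ ⥤ CommMonCat.{w}}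
  {C₂ : Type u'} [Category.{v'} C₂] (F₂ : C₂ ⥤ ElemFrobenioid Φ₂)

/-! ### Corollary 5.7 (ii) -/

/-- **Corollary 5.7 (ii), the transport step**: if `Ψ : C₁ ⥲ C₂` lies over a faithful
`Ψ^Base : D₁ → D₂` (`Base₂ ∘ Ψ ≅ Ψ^Base ∘ Base₁`), then `C₁` is of unit-profinite type iff `C₂` is —
"`Ψ` preserves the natural projection functor `C_i → D_i` [hence, in particular, the units `O^×(−)`]"
(FrdI p. 108). [cite: MochizukiFrdI2008, Cor. 5.7 (ii) p.108] -/
theorem isOfUnitProfiniteType_iff_of_square (Ψ : C₁ ≌ C₂) (ΨBase : D₁ ⥤ D₂) [ΨBase.Faithful]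
    (η : Ψ.functor ⋙ baseFunctor F₂ ≅ baseFunctor F₁ ⋙ ΨBase) :
    IsOfUnitProfiniteType F₁ ↔ IsOfUnitProfiniteType F₂ :=
  forall_admitsTfgProfiniteTopology_units_iff_of_square F₁ F₂ Ψ ΨBase η

/-- **Corollary 5.7 (ii)** DISCHARGED modulo [FrdI] Cor. 4.11 (ii) (the `1`-unique `Ψ^Base : D₁ ⥲ D₂`
over which `Ψ` lies, as typed in `DivisorMonoidCategoryTheoreticity.lean`): under the hypotheses of
Cor. 5.7, "`C₁` is of unit-profinite type if and only if `C₂` is". The printed proof (p. 108 ll. 15–21)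
reduces (ii) to the preservation of the projection functors `C_i → D_i`, i.e. to Cor. 4.11 (ii); this
theorem is exactly that reduction, kernel-checked. [cite: MochizukiFrdI2008, Cor. 5.7 (ii) p.108] -/
theorem cor57ii_of_cor411ii (Ψ : C₁ ≌ C₂)
    (h411 : (PreFrobenioidData.ofFunctor Φ₁ F₁).Cor411ii (PreFrobenioidData.ofFunctor Φ₂ F₂) Ψ) :
    Cor57ii F₁ F₂ Ψ := by
  intro hyp
  have setting : (PreFrobenioidData.ofFunctor Φ₁ F₁).Cor411Setting (PreFrobenioidData.ofFunctor Φ₂ F₂) Ψ :=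
    { divSlim := ⟨hyp.divSlim₁, hyp.divSlim₂⟩
      standard := ⟨hyp.standard₁, hyp.standard₂⟩
      hypB := fun g₁ g₂ =>
        ⟨fun _ _ φ hφ => hyp.baseIso_functor (fun A => g₁.obj A) (fun A => g₂.obj A) φ hφ,
          fun _ _ φ hφ => hyp.baseIso_inverse (fun A => g₁.obj A) (fun A => g₂.obj A) φ hφ⟩ }
  obtain ⟨ΨBase, ⟨hEq, ⟨η⟩, -⟩, -⟩ := h411 setting
  haveI := hEq
  exact isOfUnitProfiniteType_iff_of_square F₁ F₂ Ψ ΨBase η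

/-! ### Corollary 5.7 (i): base-sections -/

variable (Ψ : C₁ ≌ C₂)

/-- **Corollary 5.7 (i)**, base-sections, DISCHARGED modulo [FrdI] Thm. 3.4 (iii) and Cor. 4.11 (ii) (as
typed in `BaseCategoryTheoreticity.lean` / `DivisorMonoidCategoryTheoreticity.lean`): under the
hypotheses of Cor. 5.7, `Ψ` maps every base-section `P₁` of `C₁` into a base-section of `C₂` — namely
its image `{Ψ(A)}, {Ψ(f)}` (a subcategory because objects of a base-section isomorphic in `C₁` are
equal), whose arrows are pull-back morphisms (Thm. 3.4 (iii)), which is a skeleton, whose objects are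
Frobenius-trivial (Thm. 3.4 (iii): Frobenius type and `Ψ^{N_{≥1}}`; Cor. 4.11 (ii): base-identity) and
which is equivalent to `D₂` (through `P₁ ⥲ D₁ ⥲_{Ψ^Base} D₂`). The printed proof (p. 108) is exactly this
"sorting through the definitions". [cite: MochizukiFrdI2008, Cor. 5.7 (i) p.108] -/
theorem cor57i_sections_of
    (h34 : (PreFrobenioidData.ofFunctor Φ₁ F₁).Thm34iii (PreFrobenioidData.ofFunctor Φ₂ F₂) Ψ)
    (h411 : (PreFrobenioidData.ofFunctor Φ₁ F₁).Cor411ii (PreFrobenioidData.ofFunctor Φ₂ F₂) Ψ) :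
    Cor57i_sections F₁ F₂ Ψ := by
  intro hyp P₁ hP
  have hB : (PreFrobenioidData.ofFunctor Φ₁ F₁).HypB (PreFrobenioidData.ofFunctor Φ₂ F₂) Ψ := fun g₁ g₂ =>
    ⟨fun _ _ φ hφ => hyp.baseIso_functor (fun A => g₁.obj A) (fun A => g₂.obj A) φ hφ,
      fun _ _ φ hφ => hyp.baseIso_inverse (fun A => g₁.obj A) (fun A => g₂.obj A) φ hφ⟩
  obtain ⟨⟨hft, -, -, -, hpb, -, -⟩, ΨN, hN, -⟩ := h34 hyp.standard₁ hyp.standard₂ hB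
  obtain ⟨ΨBase, ⟨hEq, ⟨η⟩, -⟩, -⟩ :=
    h411 { divSlim := ⟨hyp.divSlim₁, hyp.divSlim₂⟩, standard := ⟨hyp.standard₁, hyp.standard₂⟩, hypB := hB }
  haveI := hEq
  -- the image presection
  let P₂ : Presection C₂ :=
    { obj := fun B => ∃ A : C₁, P₁.obj A ∧ Ψ.functor.obj A = B
      hom := fun {B B'} g => ∃ (A A' : C₁) (f : A ⟶ A') (hA : Ψ.functor.obj A = B)
        (hA' : Ψ.functor.obj A' = B'), P₁.hom f ∧ g = eqToHom hA.symm ≫ Ψ.functor.map f ≫ eqToHom hA'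
      obj_of_hom := by
        rintro B B' g ⟨A, A', f, hA, hA', hf, -⟩
        exact ⟨⟨A, (P₁.obj_of_hom f hf).1, hA⟩, ⟨A', (P₁.obj_of_hom f hf).2, hA'⟩⟩
      hom_id := by
        rintro B ⟨A, hA, rfl⟩
        exact ⟨A, A, 𝟙 A, rfl, rfl, P₁.hom_id hA, by simp⟩
      hom_comp := by
        rintro B B' B'' g g' ⟨A, A', f, rfl, rfl, hf, rfl⟩ ⟨A₁, A₁', f', hA₁, rfl, hf', rfl⟩
        obtain rfl := hP.eq_of_iso F₁ (P₁.obj_of_hom f' hf').1 (P₁.obj_of_hom f hf).2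
          (Ψ.functor.preimageIso (eqToIso hA₁))
        exact ⟨A, A₁', f ≫ f', rfl, rfl, P₁.hom_comp f f' hf hf', by simp⟩ }
  have hobj : ∀ B : C₂, P₂.obj B ↔ ∃ A : C₁, P₁.obj A ∧ Ψ.functor.obj A = B := fun B => Iff.rfl
  have hhom : ∀ ⦃B B' : C₂⦄ (g : B ⟶ B'), P₂.hom g ↔
      ∃ (A A' : C₁) (f : A ⟶ A') (hA : Ψ.functor.obj A = B) (hA' : Ψ.functor.obj A' = B'),
        P₁.hom f ∧ g = eqToHom hA.symm ≫ Ψ.functor.map f ≫ eqToHom hA' := fun B B' g => Iff.rfl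
  exact ⟨P₂, image_isBaseSection F₁ F₂ Ψ hP ΨBase η hpb hft ΨN hN hobj hhom, fun A hA => ⟨A, hA, rfl⟩,
    fun A B f hf => ⟨A, B, f, rfl, rfl, hf, by simp⟩⟩

/-! ### Corollary 5.7 (i): quasi-base-Frobenius pairs; the pre-model half of "model type" -/

variable {P₁ : Presection C₁}

/-- The transport of a base-Frobenius pair `(P₁, F₁)` along `Ψ`, over explicit data: the square
`η : Base₂ ∘ Ψ ≅ Ψ^Base ∘ Base₁` (Cor. 4.11 (ii)), preservation of pull-back morphisms and of morphisms of
Frobenius type, and the automorphism `Ψ^{N_{≥1}}` of Thm. 3.4 (iii). Produces the base-Frobenius pair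
`(Ψ(P₁), F₂)` with `Ψ(F₁(n)_A) = F₂(Ψ^{N_{≥1}} n)_{Ψ A}`. [cite: MochizukiFrdI2008, Cor. 5.7 (i) p.108] -/
theorem cor57i_pairs_core (ΨBase : D₁ ⥤ D₂) [ΨBase.IsEquivalence]
    (η : Ψ.functor ⋙ baseFunctor F₂ ≅ baseFunctor F₁ ⋙ ΨBase)
    (hpb : PreFrobenioidData.PreservesMor Ψ.functor (PreFrobenioidData.ofFunctor Φ₁ F₁).IsPullbackMorphism
      (PreFrobenioidData.ofFunctor Φ₂ F₂).IsPullbackMorphism)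
    (hft : PreFrobenioidData.PreservesMor Ψ.functor (PreFrobenioidData.ofFunctor Φ₁ F₁).IsFrobeniusType
      (PreFrobenioidData.ofFunctor Φ₂ F₂).IsFrobeniusType)
    (ΨN : ℕ+ ≃* ℕ+) (hN' : ∀ ⦃A B : C₁⦄ (φ : A ⟶ B), degFr F₂ (Ψ.functor.map φ) = ΨN (degFr F₁ φ))
    {Fr₁ : ℕ+ →* End P₁.ι} (hPF : IsBaseFrobeniusPair F₁ P₁ Fr₁) :
    ∃ (P₂ : Presection C₂) (Fr₂ : ℕ+ →* End P₂.ι) (h : MapsInto Ψ P₁ P₂),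
      IsBaseFrobeniusPair F₂ P₂ Fr₂ ∧
        ∀ (n : ℕ+) (A : C₁) (hA : P₁.obj A),
          Ψ.functor.map ((Fr₁ n).app ⟨A, hA⟩) = (Fr₂ (ΨN n)).app ⟨Ψ.functor.obj A, h.1 A hA⟩ := by
  have hP := hPF.isBaseSection
  have hFS := hPF.isFrobeniusSection
  -- the image presection (as in `cor57i_sections_of`)
  let P₂ : Presection C₂ :=
    { obj := fun B => ∃ A : C₁, P₁.obj A ∧ Ψ.functor.obj A = B
      hom := fun {B B'} g => ∃ (A A' : C₁) (f : A ⟶ A') (hA : Ψ.functor.obj A = B)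
        (hA' : Ψ.functor.obj A' = B'), P₁.hom f ∧ g = eqToHom hA.symm ≫ Ψ.functor.map f ≫ eqToHom hA'
      obj_of_hom := by
        rintro B B' g ⟨A, A', f, hA, hA', hf, -⟩
        exact ⟨⟨A, (P₁.obj_of_hom f hf).1, hA⟩, ⟨A', (P₁.obj_of_hom f hf).2, hA'⟩⟩
      hom_id := by
        rintro B ⟨A, hA, rfl⟩
        exact ⟨A, A, 𝟙 A, rfl, rfl, P₁.hom_id hA, by simp⟩
      hom_comp := by
        rintro B B' B'' g g' ⟨A, A', f, rfl, rfl, hf, rfl⟩ ⟨A₁, A₁', f', hA₁, rfl, hf', rfl⟩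
        obtain rfl := hP.eq_of_iso F₁ (P₁.obj_of_hom f' hf').1 (P₁.obj_of_hom f hf).2
          (Ψ.functor.preimageIso (eqToIso hA₁))
        exact ⟨A, A₁', f ≫ f', rfl, rfl, P₁.hom_comp f f' hf hf', by simp⟩ }
  have hobj : ∀ B : C₂, P₂.obj B ↔ ∃ A : C₁, P₁.obj A ∧ Ψ.functor.obj A = B := fun B => Iff.rfl
  have hhom : ∀ ⦃B B' : C₂⦄ (g : B ⟶ B'), P₂.hom g ↔
      ∃ (A A' : C₁) (f : A ⟶ A') (hA : Ψ.functor.obj A = B) (hA' : Ψ.functor.obj A' = B'),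
        P₁.hom f ∧ g = eqToHom hA.symm ≫ Ψ.functor.map f ≫ eqToHom hA' := fun B B' g => Iff.rfl
  have hP₂ : IsBaseSection F₂ P₂ := image_isBaseSection F₁ F₂ Ψ hP ΨBase η hpb hft ΨN hN' hobj hhom
  -- the components of `F₁`, with their types read in `C₁` (`F₁(k)_A : A ⟶ A`)
  let e : ∀ (k : ℕ+) (A : C₁), P₁.obj A → (A ⟶ A) := fun k A hA => (Fr₁ k).app ⟨A, hA⟩
  have he_deg : ∀ (k : ℕ+) (A : C₁) (hA : P₁.obj A), degFr F₁ (e k A hA) = k :=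
    fun k A hA => hFS.degFr_eq k ⟨A, hA⟩
  have he_bi : ∀ (k : ℕ+) (A : C₁) (hA : P₁.obj A), IsBaseIdentity F₁ (e k A hA) :=
    fun k A hA => hFS.isBaseIdentity k ⟨A, hA⟩
  have he_ft : ∀ (k : ℕ+) (A : C₁) (hA : P₁.obj A), IsFrobeniusType F₁ (e k A hA) :=
    fun k A hA => hFS.isFrobeniusType k ⟨A, hA⟩
  have he_one : ∀ (A : C₁) (hA : P₁.obj A), e 1 A hA = 𝟙 A := fun A hA => by
    show (Fr₁ 1).app ⟨A, hA⟩ = _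
    rw [map_one]
    rfl
  have he_mul : ∀ (k k' : ℕ+) (A : C₁) (hA : P₁.obj A), e (k * k') A hA = e k' A hA ≫ e k A hA :=
    fun k k' A hA => by
    show (Fr₁ (k * k')).app ⟨A, hA⟩ = (Fr₁ k').app ⟨A, hA⟩ ≫ (Fr₁ k).app ⟨A, hA⟩
    rw [map_mul, End.mul_def, NatTrans.comp_app]
  have he_nat : ∀ (k : ℕ+) {A A' : C₁} (hA : P₁.obj A) (hA' : P₁.obj A') (f : A ⟶ A'), P₁.hom f →
      f ≫ e k A' hA' = e k A hA ≫ f := fun k A A' hA hA' f hf => by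
    let XA : P₁.Cat := ⟨A, hA⟩
    let XA' : P₁.Cat := ⟨A', hA'⟩
    let φ : XA ⟶ XA' := ⟨f, hf⟩
    exact (Fr₁ k).naturality φ
  -- a preimage in `P₁` of every object of `P₂`
  have hex : ∀ X : P₂.Cat, ∃ A : C₁, P₁.obj A ∧ Ψ.functor.obj A = X.1 := fun X => X.2
  choose a ha hΨa using hex
  -- the transported Frobenius-section: `F₂(m)_X := Ψ(F₁(ΨN⁻¹ m)_{a X})`, conjugated into `End(X)`
  let app : ℕ+ → ∀ X : P₂.Cat, (X.1 ⟶ X.1) := fun m X =>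
    eqToHom (hΨa X).symm ≫ Ψ.functor.map (e (ΨN.symm m) (a X) (ha X)) ≫ eqToHom (hΨa X)
  -- its value through any presentation `Ψ A = X`
  have happ : ∀ (m : ℕ+) (X : P₂.Cat) (A : C₁) (hA : P₁.obj A) (hAX : Ψ.functor.obj A = X.1),
      app m X = eqToHom hAX.symm ≫ Ψ.functor.map (e (ΨN.symm m) A hA) ≫ eqToHom hAX :=
    fun m X A hA hAX => image_component_eq F₁ Ψ hP (e (ΨN.symm m)) hA (ha X) hAX (hΨa X)
  have happ' : ∀ (m : ℕ+) (A : C₁) (hA : P₁.obj A) (hX : P₂.obj (Ψ.functor.obj A)),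
      app m ⟨Ψ.functor.obj A, hX⟩ = Ψ.functor.map (e (ΨN.symm m) A hA) :=
    fun m A hA hX => image_component_eq' F₁ Ψ hP (e (ΨN.symm m)) hA (ha _) (hΨa ⟨Ψ.functor.obj A, hX⟩)
  let Frn : ℕ+ → End P₂.ι := fun m =>
    { app := app m
      naturality := by
        intro X Y g
        obtain ⟨A, A', f, hA, hA', hf, hg⟩ := (hhom g.1).mp g.2
        have hA₁ : P₁.obj A := (P₁.obj_of_hom f hf).1
        have hA₁' : P₁.obj A' := (P₁.obj_of_hom f hf).2
        show g.1 ≫ app m Y = app m X ≫ g.1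
        rw [happ m X A hA₁ hA, happ m Y A' hA₁' hA', hg]
        simp only [Category.assoc, eqToHom_trans_assoc, eqToHom_refl, Category.id_comp]
        rw [← Ψ.functor.map_comp_assoc, he_nat (ΨN.symm m) hA₁ hA₁' f hf, Ψ.functor.map_comp_assoc] }
  have hFrn : ∀ m X, (Frn m).app X = app m X := fun m X => rfl
  let Fr₂ : ℕ+ →* End P₂.ι :=
    { toFun := Frn
      map_one' := by
        apply NatTrans.ext
        funext X
        show app 1 X = 𝟙 X.1
        obtain ⟨A, hA, hAX⟩ := X.2
        rw [happ 1 X A hA hAX, map_one, he_one, CategoryTheory.Functor.map_id]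
        simp
      map_mul' := by
        intro m m'
        apply NatTrans.ext
        funext X
        show app (m * m') X = app m' X ≫ app m X
        obtain ⟨A, hA, hAX⟩ := X.2
        rw [happ _ X A hA hAX, happ _ X A hA hAX, happ _ X A hA hAX, map_mul, he_mul,
          Ψ.functor.map_comp]
        simp only [Category.assoc, eqToHom_trans_assoc, eqToHom_refl, Category.id_comp] }
  have hFr₂ : ∀ (m : ℕ+) (X : P₂.Cat) (A : C₁) (hA : P₁.obj A) (hAX : Ψ.functor.obj A = X.1),
      (Fr₂ m).app X = eqToHom hAX.symm ≫ Ψ.functor.map (e (ΨN.symm m) A hA) ≫ eqToHom hAX :=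
    fun m X A hA hAX => happ m X A hA hAX
  have hFr₂' : ∀ (m : ℕ+) (A : C₁) (hA : P₁.obj A) (hX : P₂.obj (Ψ.functor.obj A)),
      (Fr₂ m).app ⟨Ψ.functor.obj A, hX⟩ = Ψ.functor.map (e (ΨN.symm m) A hA) :=
    fun m A hA hX => happ' m A hA hX
  refine ⟨P₂, Fr₂, ⟨fun A hA => ⟨A, hA, rfl⟩, fun A B f hf => ⟨A, B, f, rfl, rfl, hf, by simp⟩⟩,
    ⟨hP₂, ⟨?_, ?_, ?_⟩⟩, ?_⟩
  · -- (a) Frobenius degrees: `deg_Fr(Ψ(F₁(ΨN⁻¹ m)_A)) = ΨN (ΨN⁻¹ m) = m`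
    intro m X
    obtain ⟨A, hA, hAX⟩ := X.2
    rw [hFr₂ m X A hA hAX]
    refine (degFr_eqToHom_conj F₂ hAX _).trans ?_
    rw [hN', he_deg, MulEquiv.apply_symm_apply]
  · -- (b) base-identity, through the square over `Ψ^Base`
    intro m X
    obtain ⟨A, hA, hAX⟩ := X.2
    rw [hFr₂ m X A hA hAX]
    exact (isBaseIdentity_eqToHom_conj_iff F₂ hAX _).mpr
      ((isBaseIdentity_map_iff_of_square F₁ F₂ Ψ ΨBase η _).mpr (he_bi _ A hA))
  · -- (b) Frobenius type, preserved by `Ψ` (Thm. 3.4 (iii))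
    intro m X
    obtain ⟨A, hA, hAX⟩ := X.2
    rw [hFr₂ m X A hA hAX]
    exact (isFrobeniusType_eqToHom_conj_iff F₂ hAX _).mpr
      ((PreFrobenioidData.ofFunctor_isFrobeniusType F₂ _).mp
        (hft _ ((PreFrobenioidData.ofFunctor_isFrobeniusType F₁ _).mpr (he_ft _ A hA))))
  · -- `Ψ(F₁(n)_A) = F₂(ΨN n)_{Ψ A}`
    intro n A hA
    rw [hFr₂' (ΨN n) A hA, MulEquiv.symm_apply_apply]
    rfl

/-- **Corollary 5.7 (i)**, quasi-base-Frobenius pairs, DISCHARGED modulo [FrdI] Thm. 3.4 (iii) and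
Cor. 4.11 (ii) (as typed): `Ψ` maps every base-Frobenius pair `(P₁, F₁)` of `C₁` to the base-Frobenius
pair `(Ψ(P₁), F₂)` of `C₂`, `F₂(m)_{Ψ A} := Ψ(F₁((Ψ^{N_{≥1}})⁻¹ m)_A)`, the Frobenius-sections matching up
to the automorphism `τ = Ψ^{N_{≥1}}` of `N_{≥1}` given by Thm. 3.4 (iii) — the "quasi-" of the printed
statement. [cite: MochizukiFrdI2008, Cor. 5.7 (i) p.108] -/
theorem cor57i_pairs_of
    (h34 : (PreFrobenioidData.ofFunctor Φ₁ F₁).Thm34iii (PreFrobenioidData.ofFunctor Φ₂ F₂) Ψ)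
    (h411 : (PreFrobenioidData.ofFunctor Φ₁ F₁).Cor411ii (PreFrobenioidData.ofFunctor Φ₂ F₂) Ψ) :
    Cor57i_pairs F₁ F₂ Ψ := by
  intro hyp P₁ Fr₁ hPF
  have hB : (PreFrobenioidData.ofFunctor Φ₁ F₁).HypB (PreFrobenioidData.ofFunctor Φ₂ F₂) Ψ := fun g₁ g₂ =>
    ⟨fun _ _ φ hφ => hyp.baseIso_functor (fun A => g₁.obj A) (fun A => g₂.obj A) φ hφ,
      fun _ _ φ hφ => hyp.baseIso_inverse (fun A => g₁.obj A) (fun A => g₂.obj A) φ hφ⟩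
  obtain ⟨⟨hft, -, -, -, hpb, -, -⟩, ΨN, hN, -⟩ := h34 hyp.standard₁ hyp.standard₂ hB
  obtain ⟨ΨBase, ⟨hEq, ⟨η⟩, -⟩, -⟩ :=
    h411 { divSlim := ⟨hyp.divSlim₁, hyp.divSlim₂⟩, standard := ⟨hyp.standard₁, hyp.standard₂⟩, hypB := hB }
  haveI := hEq
  obtain ⟨P₂, Fr₂, h, hPF₂, hc⟩ := cor57i_pairs_core F₁ F₂ Ψ ΨBase η hpb hft ΨN hN hPF
  exact ⟨P₂, Fr₂, ΨN, h, hPF₂, hc⟩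

/-- **Corollary 5.7 (i)**, "In particular, `C₁` is of model type iff `C₂` is" — the PRE-MODEL half
(Def. 2.7 (iii): existence of a base-Frobenius pair), DISCHARGED modulo [FrdI] Thm. 3.4 (iii) and
Cor. 4.11 (ii) for `Ψ` and for `Ψ⁻¹`. (The Def. 4.5 (i) "model type" half of `Cor57i_model` takes the
model-type predicate as a free parameter and is not asserted here.) [cite: MochizukiFrdI2008, Cor. 5.7 (i) p.108] -/
theorem isOfPreModelType_iff_of
    (h34 : (PreFrobenioidData.ofFunctor Φ₁ F₁).Thm34iii (PreFrobenioidData.ofFunctor Φ₂ F₂) Ψ)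
    (h411 : (PreFrobenioidData.ofFunctor Φ₁ F₁).Cor411ii (PreFrobenioidData.ofFunctor Φ₂ F₂) Ψ)
    (h34' : (PreFrobenioidData.ofFunctor Φ₂ F₂).Thm34iii (PreFrobenioidData.ofFunctor Φ₁ F₁) Ψ.symm)
    (h411' : (PreFrobenioidData.ofFunctor Φ₂ F₂).Cor411ii (PreFrobenioidData.ofFunctor Φ₁ F₁) Ψ.symm)
    (hyp : Cor57Hypotheses F₁ F₂ Ψ) : IsOfPreModelType F₁ ↔ IsOfPreModelType F₂ := by
  have hyp' : Cor57Hypotheses F₂ F₁ Ψ.symm :=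
    { isFrobenioid₁ := hyp.isFrobenioid₂
      isFrobenioid₂ := hyp.isFrobenioid₁
      perfFactorial₁ := hyp.perfFactorial₂
      perfFactorial₂ := hyp.perfFactorial₁
      divSlim₁ := hyp.divSlim₂
      divSlim₂ := hyp.divSlim₁
      standard₁ := hyp.standard₂
      standard₂ := hyp.standard₁
      baseIso_functor := fun g₂ g₁ => hyp.baseIso_inverse g₁ g₂
      baseIso_inverse := fun g₂ g₁ => hyp.baseIso_functor g₁ g₂ }
  constructor
  · rintro ⟨P₁, Fr₁, hPF⟩
    obtain ⟨P₂, Fr₂, -, -, hPF₂, -⟩ := cor57i_pairs_of F₁ F₂ Ψ h34 h411 hyp P₁ Fr₁ hPF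
    exact ⟨P₂, Fr₂, hPF₂⟩
  · rintro ⟨P₂, Fr₂, hPF⟩
    obtain ⟨P₁, Fr₁, -, -, hPF₁, -⟩ := cor57i_pairs_of F₂ F₁ Ψ.symm h34' h411' hyp' P₂ Fr₂ hPF
    exact ⟨P₁, Fr₁, hPF₁⟩

end Cor57

end PreFrobenioid

end Literature.AlgebraicGeometry.Frobenioids
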